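import Literature.MathematicalPhysics.QuantumFieldTheory.Balaban1983to89.B5Leibniz121

/-!
# `Balaban1983to89.B5DirichletDg` — a concrete Dirichlet operator `Dg` (`|∇A|`) for the (1.128) leaves:
# `‖Dg A‖ = √(dirichlet w A)` via a Gram factor of the positive graph Laplacian

T. Bałaban, *Propagators and renormalization transformations for lattice gauge theories. I*, Commun. Math. Phys.
**95**, 17–40 (1984) [Balaban1984PropagatorsI] (cell paper B5): p. 26 [PDF 10] ((1.48)), p. 38 [PDF 22] ((1.128)).
Renders `1984-cmp95-propagators-rt-I-p010-x2.png`, `-p022-x2.png` (cell folder `b2b-balaban-ref1/pages/`) read as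
images by this seat (pv15-g6).

CITATION HEADER (lean-in-tree rule 2026-08-18).  PRINTED, p. 38, verbatim: *"Defining 2δ₀ = min{⅓δ′₀, M₀^{−1}}, we
obtain |h_{z₁}K(h_{z₂})A| ≦ O(M₀^{−1})e^{−2δ₀|z₁−z₂|}(|∇A| + |A|). (1.128)"*.  P. 26, verbatim (the Dirichlet form
behind `|∇A|`): *"h(A, ω, λ) = ½⟨∂A, ∂A⟩ + ⟨ω, Q_kA − B⟩ + ⟨λ, R∂^*A⟩ = ½⟨A, ΔA⟩ − ½⟨∂^*A, ∂^*A⟩ + ⟨ω, Q_kA − B⟩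
+ ⟨λ, R∂^*A⟩, Rλ = λ, (1.48)"*.

WHAT THE CELL ALREADY HAS (imported / untouched).  pv15's `B5Leibniz121`: the Dirichlet form
`dirichlet w A = Σ_i Σ_j w_ij (A_j − A_i)²`, the kernel `lapKer w`, the torus axis weights `axisW` / `axisWC` with
`isAxisLap_torus` / `isAxisLap_prod`, and `norm_comm_lap_le` (the Laplacian part of (1.121)/(1.128) with
`√(dirichlet w A)` on the right).  Every typed (1.128) leaf downstream — pv15's `B5Decay126.h128_of_constituents`,
`B5AveragingTorus.h128_balaban_torus`, b05-g7's `B5QGGQ145Position.h128_multiplier`, pv15-g6's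
`B5DPD126Gradient.h128_gradient` — states the printed `|∇A|` through an ABSTRACT operator
`Dg : Module.End ℝ (EuclideanSpace ℝ ι)` under the domination hypothesis `∀ A, √(dirichlet axisWC A) ≤ ‖Dg A‖`.
LOCATED GAP (cell census G-B5-38 (b), b05-g7; owned by the pv15 lineage): a CONCRETE `Dg`.

THIS FILE (journal node DIRICHLET-DG of the cell `pub-balaban`, unit b2b-balaban-pv15-g6) closes G-B5-38 (b),
sorry-free, for EVERY carrier at once:
* §1 GENERIC (`ι` finite, `w` symmetric): **`gramD w`** `= 2(diag(Σ_j w_ij) − w)` (`gramD_apply`: `= −2·lapKer w`,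
  twice the POSITIVE graph Laplacian — pv15's `kerOp (lapKer w)` is minus it); **`dotProduct_gramD`**:
  `xᵀ(gramD w)x = Σ_i Σ_j w_ij (x_j − x_i)²` (`= dirichlet w`, `dotProduct_gramD_eq_dirichlet`); `gramD_transpose`,
  **`gramD_posSemidef`** (`w ≥ 0` symmetric); **`exists_gramD_eq_transpose_mul`**: a Gram factor `Bᵀ B = gramD w`
  (Mathlib's C⋆-order on real matrices: `PosSemidef ⇒ 0 ≤ M ⇒ M = star B * B`); the chosen factor **`gradFactor`**
  (`gradFactor_spec`) and the operator **`dirOp w := toEuclideanLin (gradFactor w)`** with **`norm_dirOp_sq`** /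
  **`norm_dirOp`**: `‖dirOp w A‖ = √(dirichlet w A)` EXACTLY, hence `sqrt_dirichlet_le_norm_dirOp`;
* §2 THE TORUS INSTANCE: `dn_up`, `eq_up_iff`, `eq_dn_iff` (`y = x ± e_μ ↔ x = y ∓ e_μ`), **`axisW_symm`**,
  **`axisWC_symm`**, `axisWC_nonneg`, and **`DgAxis N κ := dirOp axisWC`** on `ℓ²(UT N × κ)` with **`norm_DgAxis`**
  (`‖DgAxis A‖ = √(dirichlet axisWC A)`) and **`sqrt_dirichlet_le_norm_DgAxis`** — the `hDg` hypothesis of all four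
  leaves DISCHARGED (with equality), e.g. `h128_gradient … (DgAxis (fun i => n * N i) (Fin (d+1)))
  sqrt_dirichlet_le_norm_DgAxis`.

DICTIONARY / HONEST SCOPE.  (i) `‖DgAxis A‖² = dirichlet axisWC A = Σ_{(x,κ)} Σ_μ [(A(x+e_μ,κ) − A(x,κ))² +
(A(x−e_μ,κ) − A(x,κ))²]` = TWICE the forward-difference energy `‖∂A‖²` in `ξ`-units with unit spacing and `U = 1`
(each unordered edge counted twice, as `B5Leibniz121.dirichlet` says) — so `DgAxis` is `√2·|∇A|` of the print up
to the `η`-weights; the factor and the `η⁻¹` of `∂^η` belong to the `η`-rescaling bookkeeping (G-B5-38 (d)), not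
typed here.  (ii) `gradFactor` is SOME Gram factor (chosen by `Classical.choose` from the C⋆-algebra square-root
existence), not the explicit forward-gradient matrix; only `‖Dg A‖` enters (1.128), and it is determined:
`‖Dg A‖ = √(dirichlet A)` for every Gram factor.  (iii) Nothing imported is edited; the downstream (1.128) leaves are
instantiated by APPLICATION (no new versions needed).  Value = kernel certificate closing a located gap of the cell
census, NOT summit progress.

Tags: 23 `[folklore]` (all 23 declarations: finite-dimensional linear algebra and torus combinatorics; the two printed
displays above are context, not typed claims).  No `sorry`, no new axioms; imports `B5Leibniz121` only.
-/

namespace Literature.MathematicalPhysics.QuantumFieldTheory.Balaban1983to89.B5DirichletDg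

open Literature.MathematicalPhysics.QuantumFieldTheory.Balaban1983to89
open B5TorusCover B5Leibniz121
open scoped Real Matrix Matrix.Norms.L2Operator MatrixOrder

noncomputable section

/-! ### §1 The Dirichlet form as a Gram quadratic form and its square-root operator -/

section Generic

variable {ι : Type} [Fintype ι] [DecidableEq ι]

/-- MODEL. The matrix of the Dirichlet form `D_w(A) = Σ_i Σ_j w_ij (A_j − A_i)²` of a symmetric weight:
`M_w = 2(diag(Σ_j w_ij) − w)` (twice MINUS pv15's `lapKer w`, i.e. twice the positive graph Laplacian). [folklore] -/
def gramD (w : ι → ι → ℝ) : Matrix ι ι ℝ :=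
  Matrix.of fun i j => 2 * ((if i = j then ∑ j', w i j' else 0) - w i j)

/-- `M_w = −2·lapKer w` entrywise. [folklore] -/
theorem gramD_apply (w : ι → ι → ℝ) (i j : ι) : gramD w i j = -2 * lapKer w i j := by
  simp only [gramD, lapKer, Matrix.of_apply]
  ring

/-- `xᵀ M_w x = D_w(x)` for symmetric `w`. [folklore] -/
theorem dotProduct_gramD {w : ι → ι → ℝ} (hw : ∀ i j, w i j = w j i) (x : ι → ℝ) :
    x ⬝ᵥ (gramD w *ᵥ x) = ∑ i, ∑ j, w i j * (x j - x i) ^ 2 := by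
  have hL : x ⬝ᵥ (gramD w *ᵥ x) = ∑ i, (2 * (∑ j, w i j) * x i ^ 2 - ∑ j, 2 * w i j * x i * x j) := by
    simp only [dotProduct, Matrix.mulVec, gramD, Matrix.of_apply]
    refine Finset.sum_congr rfl fun i _ => ?_
    simp only [mul_sub, sub_mul, Finset.sum_sub_distrib, Finset.mul_sum, mul_ite, ite_mul, zero_mul, mul_zero,
      Finset.sum_ite_eq, Finset.mem_univ, if_true]
    refine congrArg₂ _ (by ring) (Finset.sum_congr rfl fun j _ => by ring)
  have hR : ∑ i, ∑ j, w i j * (x j - x i) ^ 2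
      = ∑ i, ∑ j, w i j * x j ^ 2 + ∑ i, ∑ j, w i j * x i ^ 2 - ∑ i, ∑ j, 2 * w i j * x i * x j := by
    rw [← Finset.sum_add_distrib, ← Finset.sum_sub_distrib]
    refine Finset.sum_congr rfl fun i _ => ?_
    rw [← Finset.sum_add_distrib, ← Finset.sum_sub_distrib]
    exact Finset.sum_congr rfl fun j _ => by ring
  have hS : ∑ i, ∑ j, w i j * x j ^ 2 = ∑ i, ∑ j, w i j * x i ^ 2 := by
    rw [Finset.sum_comm]
    exact Finset.sum_congr rfl fun i _ => Finset.sum_congr rfl fun j _ => by rw [hw]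
  rw [hL, hR, hS, Finset.sum_sub_distrib]
  congr 1
  rw [← two_mul, Finset.mul_sum]
  exact Finset.sum_congr rfl fun i _ => by rw [mul_assoc, Finset.sum_mul]

/-- `xᵀ M_w x = D_w` on `EuclideanSpace`. [folklore] -/
theorem dotProduct_gramD_eq_dirichlet {w : ι → ι → ℝ} (hw : ∀ i j, w i j = w j i) (A : EuclideanSpace ℝ ι) :
    WithLp.ofLp A ⬝ᵥ (gramD w *ᵥ WithLp.ofLp A) = dirichlet w A :=
  dotProduct_gramD hw _

/-- `M_w` is symmetric. [folklore] -/
theorem gramD_transpose {w : ι → ι → ℝ} (hw : ∀ i j, w i j = w j i) : (gramD w)ᵀ = gramD w := by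
  ext i j
  simp only [Matrix.transpose_apply, gramD, Matrix.of_apply]
  by_cases h : i = j
  · subst h; rfl
  · rw [if_neg h, if_neg (Ne.symm h), hw]

/-- `M_w` is positive semidefinite for a symmetric nonnegative weight. [folklore] -/
theorem gramD_posSemidef {w : ι → ι → ℝ} (hw : ∀ i j, w i j = w j i) (hw0 : ∀ i j, 0 ≤ w i j) :
    (gramD w).PosSemidef := by
  refine Matrix.PosSemidef.of_dotProduct_mulVec_nonneg ?_ fun x => ?_
  · rw [Matrix.IsHermitian, Matrix.conjTranspose_eq_transpose_of_trivial, gramD_transpose hw]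
  · rw [star_trivial, dotProduct_gramD hw]
    exact Finset.sum_nonneg fun i _ => Finset.sum_nonneg fun j _ => mul_nonneg (hw0 i j) (sq_nonneg _)

/-- a Gram factor of the Dirichlet matrix exists: `M_w = Bᵀ B` (C⋆-order on real matrices). [folklore] -/
theorem exists_gramD_eq_transpose_mul {w : ι → ι → ℝ} (hw : ∀ i j, w i j = w j i) (hw0 : ∀ i j, 0 ≤ w i j) :
    ∃ B : Matrix ι ι ℝ, gramD w = Bᵀ * B := by
  obtain ⟨B, hB⟩ := CStarAlgebra.nonneg_iff_eq_star_mul_self.mp (gramD_posSemidef hw hw0).nonneg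
  exact ⟨B, by rw [hB, Matrix.star_eq_conjTranspose, Matrix.conjTranspose_eq_transpose_of_trivial]⟩

/-- MODEL. A lattice-gradient matrix of the weight: a chosen `B` with `Bᵀ B = M_w`. [folklore] -/
def gradFactor (w : ι → ι → ℝ) (hw : ∀ i j, w i j = w j i) (hw0 : ∀ i j, 0 ≤ w i j) : Matrix ι ι ℝ :=
  Classical.choose (exists_gramD_eq_transpose_mul hw hw0)

/-- `(gradFactor w)ᵀ · gradFactor w = gramD w`. [folklore] -/
theorem gradFactor_spec (w : ι → ι → ℝ) (hw : ∀ i j, w i j = w j i) (hw0 : ∀ i j, 0 ≤ w i j) :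
    (gradFactor w hw hw0)ᵀ * gradFactor w hw hw0 = gramD w :=
  (Classical.choose_spec (exists_gramD_eq_transpose_mul hw hw0)).symm

/-- MODEL. **The Dirichlet operator `Dg_w`** on `ℓ²(ι)`: `A ↦ B A` with `Bᵀ B = M_w`, so `‖Dg_w A‖ = √(D_w(A))`
— a concrete witness for the operator `Dg` ("`|∇A|`") of the (1.128) leaves. [folklore] -/
def dirOp (w : ι → ι → ℝ) (hw : ∀ i j, w i j = w j i) (hw0 : ∀ i j, 0 ≤ w i j) :
    Module.End ℝ (EuclideanSpace ℝ ι) :=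
  Matrix.toEuclideanLin (gradFactor w hw hw0)

/-- `dirOp` acts by the matrix `gradFactor`. [folklore] -/
theorem dirOp_apply (w : ι → ι → ℝ) (hw : ∀ i j, w i j = w j i) (hw0 : ∀ i j, 0 ≤ w i j) (A : EuclideanSpace ℝ ι) :
    dirOp w hw hw0 A = WithLp.toLp 2 (gradFactor w hw hw0 *ᵥ WithLp.ofLp A) := rfl

/-- **`‖Dg_w A‖² = D_w(A)`**. [folklore] -/
theorem norm_dirOp_sq (w : ι → ι → ℝ) (hw : ∀ i j, w i j = w j i) (hw0 : ∀ i j, 0 ≤ w i j)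
    (A : EuclideanSpace ℝ ι) : ‖dirOp w hw hw0 A‖ ^ 2 = dirichlet w A := by
  rw [← real_inner_self_eq_norm_sq, EuclideanSpace.inner_eq_star_dotProduct, star_trivial, dirOp_apply,
    WithLp.ofLp_toLp, ← dotProduct_gramD_eq_dirichlet hw, ← gradFactor_spec w hw hw0, ← Matrix.mulVec_mulVec,
    Matrix.dotProduct_mulVec _ (gradFactor w hw hw0)ᵀ, Matrix.vecMul_transpose]

/-- **`‖Dg_w A‖ = √(D_w(A))`**. [folklore] -/
theorem norm_dirOp (w : ι → ι → ℝ) (hw : ∀ i j, w i j = w j i) (hw0 : ∀ i j, 0 ≤ w i j)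
    (A : EuclideanSpace ℝ ι) : ‖dirOp w hw hw0 A‖ = Real.sqrt (dirichlet w A) := by
  rw [← norm_dirOp_sq w hw hw0 A, Real.sqrt_sq (norm_nonneg _)]

/-- the domination hypothesis `√(D_w(A)) ≤ ‖Dg A‖` of the (1.128) leaves holds (with equality) for `Dg_w`. [folklore] -/
theorem sqrt_dirichlet_le_norm_dirOp (w : ι → ι → ℝ) (hw : ∀ i j, w i j = w j i) (hw0 : ∀ i j, 0 ≤ w i j)
    (A : EuclideanSpace ℝ ι) : Real.sqrt (dirichlet w A) ≤ ‖dirOp w hw hw0 A‖ :=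
  (norm_dirOp w hw hw0 A).ge

end Generic

/-! ### §2 The axis weights of the torus are symmetric: the vector-field instance -/

section Axis

variable {d : ℕ} {N : Fin d → ℕ} [∀ i, NeZero (N i)] {κ : Type} [Fintype κ] [DecidableEq κ]

/-- `x − e_μ + e_μ = x`. [folklore] -/
theorem dn_up (x : UT N) (μ : Fin d) : dn (up x μ) μ = x := by
  unfold up dn
  have h1 : UT.toSite N (UT.ofSite N (Function.update (UT.toSite N x) μ (UT.toSite N x μ + 1))) μ
      = UT.toSite N x μ + 1 := by
    show Function.update (UT.toSite N x) μ (UT.toSite N x μ + 1) μ = _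
    rw [Function.update_self]
  rw [h1, add_sub_cancel_right]
  show UT.ofSite N (Function.update (Function.update (UT.toSite N x) μ (UT.toSite N x μ + 1)) μ
    (UT.toSite N x μ)) = x
  rw [Function.update_idem, Function.update_eq_self]
  rfl

/-- `y = x + e_μ ↔ x = y − e_μ`. [folklore] -/
theorem eq_up_iff (x y : UT N) (μ : Fin d) : y = up x μ ↔ x = dn y μ :=
  ⟨fun h => by rw [h, dn_up], fun h => by rw [h, up_dn]⟩

/-- `y = x − e_μ ↔ x = y + e_μ`. [folklore] -/
theorem eq_dn_iff (x y : UT N) (μ : Fin d) : y = dn x μ ↔ x = up y μ :=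
  ⟨fun h => by rw [h, up_dn], fun h => by rw [h, dn_up]⟩

/-- the axis weight is symmetric. [folklore] -/
theorem axisW_symm (x y : UT N) : axisW x y = axisW y x := by
  unfold axisW
  refine Finset.sum_congr rfl fun μ _ => ?_
  rw [add_comm]
  congr 1
  · exact if_congr (eq_dn_iff x y μ) rfl rfl
  · exact if_congr (eq_up_iff x y μ) rfl rfl

omit [Fintype κ] in
/-- the componentwise axis weight is symmetric. [folklore] -/
theorem axisWC_symm (p q : UT N × κ) : axisWC p q = axisWC q p := by
  unfold axisWC
  by_cases h : p.2 = q.2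
  · rw [if_pos h, if_pos h.symm, axisW_symm]
  · rw [if_neg h, if_neg (Ne.symm h)]

/-- the componentwise axis weight is nonnegative. [folklore] -/
theorem axisWC_nonneg (p q : UT N × κ) : 0 ≤ axisWC p q :=
  (isAxisLap_prod (N := N) (κ := κ)).nonneg p q

/-- MODEL. **The vector-field Dirichlet operator `Dg` on `ℓ²(UT N × κ)`** (`|∇A|` of (1.128) for fields with
components in `κ`): `‖Dg A‖ = √(dirichlet axisWC A)`. [folklore] -/
def DgAxis (N : Fin d → ℕ) [∀ i, NeZero (N i)] (κ : Type) [Fintype κ] [DecidableEq κ] :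
    Module.End ℝ (EuclideanSpace ℝ (UT N × κ)) :=
  dirOp (axisWC (N := N) (κ := κ)) axisWC_symm axisWC_nonneg

/-- **`‖Dg A‖ = √(D(A))`** for the vector-field instance. [folklore] -/
theorem norm_DgAxis (A : EuclideanSpace ℝ (UT N × κ)) :
    ‖DgAxis N κ A‖ = Real.sqrt (dirichlet (axisWC (N := N) (κ := κ)) A) :=
  norm_dirOp _ _ _ A

/-- the `hDg` hypothesis of `h128_of_constituents` / `h128_balaban_torus` / `h128_multiplier` / `h128_gradient`
DISCHARGED by `DgAxis`. [folklore] -/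
theorem sqrt_dirichlet_le_norm_DgAxis (A : EuclideanSpace ℝ (UT N × κ)) :
    Real.sqrt (dirichlet (axisWC (N := N) (κ := κ)) A) ≤ ‖DgAxis N κ A‖ :=
  (norm_DgAxis A).ge

end Axis

end

end Literature.MathematicalPhysics.QuantumFieldTheory.Balaban1983to89.B5DirichletDg
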